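import Literature.NumberTheory.LFunctions.LandauFunctionOmega
import HarnessLib

/-!
RH-FREE — an unconditional "weak duality" reduction bounding `li((log k)²) − ℓ(k)` for every
integer `k`; nothing here bears on the truth of RH.

# Landau's function `g(n)`: the additive function `ℓ` and the duality reduction for the upper bound

Massias–Nicolas–Robin [MNR 1988, §4] control `g(n) = max {orderOf σ : σ ∈ 𝔖ₙ}` through the
additive function `ℓ(k) = Σ_{p^a ∥ k} p^a`: `ℓ(orderOf σ) ≤ n` for `σ ∈ 𝔖ₙ`, so `ℓ(g(n)) ≤ n`
(MNR (3): `g(n) = max_{ℓ(k) ≤ n} k`). MNR then prove Thm 1 (iv) ("sous l'hypothèse de Riemann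
`log g(n) < √(Li⁻¹(n))` pour `n` assez grand") through Nicolas's structure theory of the
`ℓ`-superchampion numbers (the set `G`, (6)–(7)). We replace that structure theory by the
elementary **Lagrangian weak-duality inequality**: for every `ρ ≥ 0`,
`ℓ(k) − ρ log k = Σ_p (p^{v_p(k)} − ρ v_p(k) log p) ≥ Σ_p min_a (p^a − ρ a log p)`, and the
minimum is attained (up to a slack `≤ 4x^{4/3}` carried by the primes `p ≤ (2x)^{1/3}`) at the
two-layer exponent pattern `e_x(p) = 2` on `A₂(x) = {p ≤ x : p² − p ≤ (x/log x) log p}`, `= 1` on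
the other primes `p ≤ x`, `= 0` beyond `x`, when `ρ = x/log x`. Taking `x = log k` and using the
convexity of `t ↦ li(t²)` (tangent at `t = log k`, slope `x/log x = ρ`) the `ρ`-terms cancel and we
obtain the RH-free reduction (`logIntegral_sq_log_sub_ell_le`):

  `li((log k)²) − ℓ(k) ≤ li(T(x)²) − L₂(x) + 4 x^{4/3}`,  `x = log k ≥ 4`, `θ(x) ≥ e`,

where `T(x) = Σ_{p ≤ x} e_x(p) log p = θ(x) + Σ_{p ∈ A₂(x)} log p` and
`L₂(x) = Σ_{p ≤ x} p^{e_x(p)} = Σ_{p ≤ x} p + Σ_{p ∈ A₂(x)} (p² − p)`.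
The RH-conditional estimate `li(T(x)²) − L₂(x) ≤ −c x^{3/2}/log x` (which gives MNR Thm 1 (iv))
is in `LandauFunctionUpperRH.lean`.

Contents: `ell`, `ell_le_self`, `ell_lcm_le`, `ell_orderOf_le`, `ell_landauFn_le` and
`le_landauFn_of_ell_le` / `isGreatest_landauFn` (MNR §4 (3): `g(n) = max_{ℓ(k) ≤ n} k`),
`le_landauFn`, `landauFn_mono`; `cost`/`expo`/`bigT`/`lTwo`; the termwise minimality lemmas; the slack bound;
`ell_sub_mul_log_ge` (weak duality) and `logIntegral_sq_log_sub_ell_le` (the reduction).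

## References
* [MNR 1988] J.-P. Massias, J.-L. Nicolas, G. Robin, *Évaluation asymptotique de l'ordre maximum
  d'un élément du groupe symétrique*, Acta Arith. 50 (1988) 221–242: §4 (ℓ, (2)–(4)), Thm. 1 (iv).
* [DelegliseNicolas2019] M. Deléglise, J.-L. Nicolas, *The Landau function and the Riemann
  hypothesis*, J. Comb. Number Theory 11 (2019), §1.1.
-/

open Finset Real Filter
open scoped Chebyshev

namespace Literature.NumberTheory.LFunctions

namespace LandauFnUpper

/-! ## A. The additive function `ℓ` -/

/-- `ℓ(k) = Σ_{p^a ∥ k} p^a` (`ℓ(0) = ℓ(1) = 0`). [cite: MassiasNicolasRobin1988, §4 (2)–(3)] -/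
def ell (k : ℕ) : ℕ := ∑ p ∈ k.primeFactors, p ^ k.factorization p

/-- the summand of `ℓ` as a function of all naturals `p` (zero off the prime factors).
[cite: MassiasNicolasRobin1988, §4 (2)] -/
def term (k p : ℕ) : ℕ := if k.factorization p = 0 then 0 else p ^ k.factorization p

/-- `v_p(k) = 0 ↔ p ∉ primeFactors k`. [folklore] -/
private lemma factorization_eq_zero_iff_notMem {k p : ℕ} :
    k.factorization p = 0 ↔ p ∉ k.primeFactors := by
  rw [← Nat.support_factorization, Finsupp.mem_support_iff, not_not]

/-- `ℓ(k) = Σ_{p ∈ S} term k p` for any finite `S ⊇` prime factors.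
[cite: MassiasNicolasRobin1988, §4 (2)] -/
theorem ell_eq_sum_term {k : ℕ} {S : Finset ℕ} (hS : k.primeFactors ⊆ S) :
    ell k = ∑ p ∈ S, term k p := by
  unfold ell
  rw [← Finset.sum_subset hS (f := term k)]
  · refine Finset.sum_congr rfl fun p hp ↦ ?_
    have : k.factorization p ≠ 0 := fun h ↦ (factorization_eq_zero_iff_notMem.1 h) hp
    simp [term, this]
  · intro p _ hp
    simp [term, factorization_eq_zero_iff_notMem.2 hp]

/-- a sum of naturals `≥ 2` is at most their product. [folklore] -/
private lemma sum_le_prod_of_two_le {ι : Type*} [DecidableEq ι] (s : Finset ι) (f : ι → ℕ)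
    (h : ∀ i ∈ s, 2 ≤ f i) : ∑ i ∈ s, f i ≤ ∏ i ∈ s, f i := by
  induction s using Finset.induction_on with
  | empty => simp
  | insert a s ha ih =>
    rw [Finset.sum_insert ha, Finset.prod_insert ha]
    have h1 : 2 ≤ f a := h a (Finset.mem_insert_self a s)
    have h2 : ∀ i ∈ s, 2 ≤ f i := fun i hi ↦ h i (Finset.mem_insert_of_mem hi)
    have ih' := ih h2
    rcases s.eq_empty_or_nonempty with hs | ⟨i, hi⟩
    · simp [hs]
    · have hP : 2 ≤ ∏ j ∈ s, f j :=
        (h2 i hi).trans (Nat.le_of_dvd (Finset.prod_pos fun j hj ↦ by have := h2 j hj; omega)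
          (Finset.dvd_prod_of_mem f hi))
      nlinarith

/-- `ℓ(k) ≤ k` (a sum of the coprime prime-power parts is at most their product).
[cite: MassiasNicolasRobin1988, §4 (2)–(3)] -/
theorem ell_le_self (k : ℕ) : ell k ≤ k := by
  classical
  rcases eq_or_ne k 0 with rfl | hk
  · simp [ell]
  have h2 : ∀ p ∈ k.primeFactors, 2 ≤ p ^ k.factorization p := by
    intro p hp
    have hp' := Nat.prime_of_mem_primeFactors hp
    have hv : k.factorization p ≠ 0 := fun h ↦ (factorization_eq_zero_iff_notMem.1 h) hp
    calc 2 ≤ p := hp'.two_le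
      _ = p ^ 1 := (pow_one p).symm
      _ ≤ p ^ k.factorization p := Nat.pow_le_pow_right hp'.pos (Nat.one_le_iff_ne_zero.mpr hv)
  calc ell k ≤ ∏ p ∈ k.primeFactors, p ^ k.factorization p := sum_le_prod_of_two_le _ _ h2
    _ = k := by
      conv_rhs => rw [← Nat.prod_factorization_pow_eq_self hk]
      rw [Finsupp.prod, Nat.support_factorization]

/-- `term (lcm a b) p ≤ term a p + term b p`. [folklore] -/
private lemma term_lcm_le {a b : ℕ} (ha : a ≠ 0) (hb : b ≠ 0) (p : ℕ) :
    term (a.lcm b) p ≤ term a p + term b p := by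
  simp only [term, Nat.factorization_lcm ha hb, Finsupp.sup_apply]
  rcases le_total (a.factorization p) (b.factorization p) with h | h
  · rw [sup_eq_right.mpr h]; split_ifs <;> omega
  · rw [sup_eq_left.mpr h]; split_ifs <;> omega

/-- `ℓ(lcm(a,b)) ≤ ℓ(a) + ℓ(b)`. [cite: MassiasNicolasRobin1988, §4 (2)–(3)] -/
theorem ell_lcm_le {a b : ℕ} (ha : a ≠ 0) (hb : b ≠ 0) : ell (a.lcm b) ≤ ell a + ell b := by
  set S := a.primeFactors ∪ b.primeFactors ∪ (a.lcm b).primeFactors with hSdef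
  rw [ell_eq_sum_term (S := S) (by intro p hp; simp [hSdef, hp]),
    ell_eq_sum_term (k := a) (S := S) (by intro p hp; simp [hSdef, hp]),
    ell_eq_sum_term (k := b) (S := S) (by intro p hp; simp [hSdef, hp]), ← Finset.sum_add_distrib]
  exact Finset.sum_le_sum fun p _ ↦ term_lcm_le ha hb p

/-- `ℓ(lcm of a multiset of positive integers) ≤ its sum`. [cite: MassiasNicolasRobin1988, §4 (3)] -/
theorem ell_multiset_lcm_le_sum (m : Multiset ℕ) (h : ∀ a ∈ m, a ≠ 0) : ell m.lcm ≤ m.sum := by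
  induction m using Multiset.induction_on with
  | empty => simp [ell]
  | cons a m ih =>
    rw [Multiset.lcm_cons, Multiset.sum_cons]
    have ha : a ≠ 0 := h a (Multiset.mem_cons_self a m)
    have hm : ∀ b ∈ m, b ≠ 0 := fun b hb ↦ h b (Multiset.mem_cons_of_mem hb)
    have hl : m.lcm ≠ 0 := by
      rw [Ne, Multiset.lcm_eq_zero_iff]; exact fun h0 ↦ hm 0 h0 rfl
    calc ell (GCDMonoid.lcm a m.lcm) = ell (a.lcm m.lcm) := rfl
      _ ≤ ell a + ell m.lcm := ell_lcm_le ha hl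
      _ ≤ a + m.sum := add_le_add (ell_le_self a) (ih hm)

/-- **`ℓ(orderOf σ) ≤ n` for `σ ∈ 𝔖ₙ`** (the order is the lcm of the cycle lengths, whose sum is
`≤ n`). [cite: MassiasNicolasRobin1988, §4 (3)] -/
theorem ell_orderOf_le {n : ℕ} (σ : Equiv.Perm (Fin n)) : ell (orderOf σ) ≤ n := by
  rw [← Equiv.Perm.lcm_cycleType]
  calc ell σ.cycleType.lcm ≤ σ.cycleType.sum :=
        ell_multiset_lcm_le_sum _ fun a ha ↦ by
          have := Equiv.Perm.two_le_of_mem_cycleType ha; omega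
    _ ≤ Fintype.card (Fin n) := σ.sum_cycleType_le
    _ = n := Fintype.card_fin n

/-- **`ℓ(g(n)) ≤ n`** (MNR §4 (3): `g(n) = max_{ℓ(k) ≤ n} k`). [cite: MassiasNicolasRobin1988, §4 (3)] -/
theorem ell_landauFn_le (n : ℕ) : ell (landauFn n) ≤ n := by
  obtain ⟨σ, -, hσ⟩ := Finset.exists_mem_eq_sup (Finset.univ : Finset (Equiv.Perm (Fin n)))
    Finset.univ_nonempty (fun σ ↦ orderOf σ)
  rw [landauFn, hσ]; exact ell_orderOf_le σ

/-- `n ≤ g(n)` (an `n`-cycle). [cite: DelegliseNicolas2019, §1.1] -/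
theorem le_landauFn (n : ℕ) : n ≤ landauFn n := by
  classical
  rcases Nat.lt_or_ge n 2 with hn | hn
  · interval_cases n
    · exact Nat.zero_le _
    · simpa using orderOf_le_landauFn (1 : Equiv.Perm (Fin 1))
  have hex : ∃ g : Equiv.Perm (Fin n), g.cycleType = {n} := by
    rw [Equiv.Perm.exists_with_cycleType_iff]
    exact ⟨by simp, fun a ha ↦ by rw [Multiset.mem_singleton.1 ha]; exact hn⟩
  obtain ⟨g, hg⟩ := hex
  have h : orderOf g = n := by
    rw [← Equiv.Perm.lcm_cycleType, hg, Multiset.lcm_singleton]; exact normalize_eq n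
  calc n = orderOf g := h.symm
    _ ≤ landauFn n := orderOf_le_landauFn g


/-! ## B. The Lagrangian cost and its termwise minimisation -/

/-- `p^a` with the convention `a = 0 ↦ 0` (the contribution of the exponent `a` to `ℓ`).
[cite: MassiasNicolasRobin1988, §4 (2)] -/
noncomputable def powOr0 (p a : ℕ) : ℝ := if a = 0 then 0 else (p : ℝ) ^ a

/-- the Lagrangian cost `p^a − ρ·a·log p` of the exponent `a` at the prime `p`.
[cite: MassiasNicolasRobin1988, §4 (4) (ℓ(N) − ρ log N)] -/
noncomputable def cost (ρ : ℝ) (p a : ℕ) : ℝ := powOr0 p a - ρ * a * Real.log p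

/-- cast of `term` to `ℝ`. [cite: MassiasNicolasRobin1988, §4 (2)] -/
theorem term_cast (k p : ℕ) : (term k p : ℝ) = powOr0 p (k.factorization p) := by
  unfold term powOr0; split_ifs <;> simp

/-- the cost of the exponent `0` is `0`. [cite: MassiasNicolasRobin1988, §4 (4)] -/
theorem cost_zero (ρ : ℝ) (p : ℕ) : cost ρ p 0 = 0 := by simp [cost, powOr0]

/-- the cost of an exponent `a ≥ 1` is `p^a − ρ a log p`. [cite: MassiasNicolasRobin1988, §4 (4)] -/
theorem cost_of_ne_zero (ρ : ℝ) (p : ℕ) {a : ℕ} (ha : a ≠ 0) :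
    cost ρ p a = (p : ℝ) ^ a - ρ * a * Real.log p := by simp [cost, powOr0, ha]

/-- **`ℓ(k) − ρ log k = Σ_{p ∈ S} cost ρ p (v_p k)`** (`S ⊇` prime factors of `k`).
[cite: MassiasNicolasRobin1988, §4 (4)] -/
theorem ell_sub_mul_log_eq (k : ℕ) (ρ : ℝ) {S : Finset ℕ} (hS : k.primeFactors ⊆ S) :
    (ell k : ℝ) - ρ * Real.log k = ∑ p ∈ S, cost ρ p (k.factorization p) := by
  have h1 : (ell k : ℝ) = ∑ p ∈ S, powOr0 p (k.factorization p) := by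
    rw [ell_eq_sum_term hS]; push_cast; exact Finset.sum_congr rfl fun p _ ↦ term_cast k p
  have h2 : Real.log k = ∑ p ∈ S, (k.factorization p : ℝ) * Real.log p := by
    rw [Real.log_nat_eq_sum_factorization, Finsupp.sum, Nat.support_factorization]
    apply Finset.sum_subset hS
    intro p _ hp
    simp [factorization_eq_zero_iff_notMem.2 hp]
  rw [h1, h2, Finset.mul_sum, ← Finset.sum_sub_distrib]
  refine Finset.sum_congr rfl fun p _ ↦ ?_
  unfold cost; ring

/-- discrete convexity of `a ↦ q^a`: `d (q^{e+1} − q^e) ≤ q^{e+d} − q^e` for `q ≥ 1`. [folklore] -/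
private lemma mul_sub_le_pow_sub_pow {q : ℝ} (hq : 1 ≤ q) (e d : ℕ) :
    (d : ℝ) * (q ^ (e + 1) - q ^ e) ≤ q ^ (e + d) - q ^ e := by
  induction d with
  | zero => simp
  | succ d ih =>
    have hqe0 : 0 < q ^ e := pow_pos (by linarith) e
    have hqe : q ^ (e + 1) = q * q ^ e := by ring
    have h0 : 0 ≤ q ^ (e + 1) - q ^ e := by rw [hqe]; nlinarith
    have hs : q ^ (e + (d + 1)) = q * q ^ (e + d) := by ring
    have step1 : q * (q ^ e + d * (q ^ (e + 1) - q ^ e)) ≤ q * q ^ (e + d) :=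
      mul_le_mul_of_nonneg_left (by linarith [ih]) (by linarith)
    have step2 : 0 ≤ (q - 1) * (d * (q ^ (e + 1) - q ^ e)) :=
      mul_nonneg (by linarith) (mul_nonneg (Nat.cast_nonneg d) h0)
    rw [hs]; push_cast
    nlinarith [step1, step2, hqe, h0]

/-- exponent `0` is optimal when `ρ log p ≤ p`. [cite: MassiasNicolasRobin1988, §4 (4)–(7)] -/
theorem cost_zero_le {ρ : ℝ} {p : ℕ} (hp : 2 ≤ p) (h1 : ρ * Real.log p ≤ p) (a : ℕ) :
    cost ρ p 0 ≤ cost ρ p a := by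
  rcases eq_or_ne a 0 with rfl | ha
  · exact le_rfl
  obtain ⟨d, rfl⟩ : ∃ d, a = d + 1 := ⟨a - 1, by omega⟩
  rw [cost_zero, cost_of_ne_zero _ _ ha]
  have hq : (1:ℝ) ≤ p := by exact_mod_cast (by omega : 1 ≤ p)
  have hp2 : (2:ℝ) ≤ p := by exact_mod_cast hp
  have key := mul_sub_le_pow_sub_pow hq 1 d
  rw [show 1 + 1 = 2 from rfl, add_comm 1 d, pow_one] at key
  have hpp : (p:ℝ) ≤ (p:ℝ) ^ 2 - p := by nlinarith
  have hd : (0:ℝ) ≤ d := Nat.cast_nonneg d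
  have e1 : (d:ℝ) * p ≤ (d:ℝ) * ((p:ℝ) ^ 2 - p) := mul_le_mul_of_nonneg_left hpp hd
  have e2 : ((d:ℝ) + 1) * (ρ * Real.log p) ≤ ((d:ℝ) + 1) * p :=
    mul_le_mul_of_nonneg_left h1 (by linarith)
  push_cast
  nlinarith [key, e1, e2]

/-- exponent `1` is optimal when `p ≤ ρ log p ≤ p² − p`. [cite: MassiasNicolasRobin1988, §4 (4)–(7)] -/
theorem cost_one_le {ρ : ℝ} {p : ℕ} (hp : 2 ≤ p) (h1 : (p:ℝ) ≤ ρ * Real.log p)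
    (h2 : ρ * Real.log p ≤ (p:ℝ) ^ 2 - p) (a : ℕ) : cost ρ p 1 ≤ cost ρ p a := by
  have hq : (1:ℝ) ≤ p := by exact_mod_cast (by omega : 1 ≤ p)
  rcases eq_or_ne a 0 with rfl | ha
  · rw [cost_zero, cost_of_ne_zero _ _ one_ne_zero]; push_cast; linarith
  obtain ⟨d, rfl⟩ : ∃ d, a = d + 1 := ⟨a - 1, by omega⟩
  rw [cost_of_ne_zero _ _ one_ne_zero, cost_of_ne_zero _ _ ha]
  have key := mul_sub_le_pow_sub_pow hq 1 d
  rw [show 1 + 1 = 2 from rfl, add_comm 1 d, pow_one] at key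
  have e1 := mul_le_mul_of_nonneg_left h2 (Nat.cast_nonneg d)
  push_cast
  nlinarith [key, e1]

/-- exponent `2` is optimal when `p² − p ≤ ρ log p ≤ p³ − p²`. [cite: MassiasNicolasRobin1988, §4 (4)–(7)] -/
theorem cost_two_le {ρ : ℝ} {p : ℕ} (hp : 2 ≤ p) (h2 : (p:ℝ) ^ 2 - p ≤ ρ * Real.log p)
    (h3 : ρ * Real.log p ≤ (p:ℝ) ^ 3 - (p:ℝ) ^ 2) (a : ℕ) : cost ρ p 2 ≤ cost ρ p a := by
  have hq : (1:ℝ) ≤ p := by exact_mod_cast (by omega : 1 ≤ p)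
  have hp2 : (2:ℝ) ≤ p := by exact_mod_cast hp
  rcases Nat.lt_or_ge a 2 with ha | ha
  · interval_cases a
    · rw [cost_zero, cost_of_ne_zero _ _ two_ne_zero]; push_cast; nlinarith
    · rw [cost_of_ne_zero _ _ one_ne_zero, cost_of_ne_zero _ _ two_ne_zero]; push_cast; nlinarith
  obtain ⟨d, rfl⟩ : ∃ d, a = d + 2 := ⟨a - 2, by omega⟩
  rw [cost_of_ne_zero _ _ two_ne_zero, cost_of_ne_zero _ _ (by omega : d + 2 ≠ 0)]
  have key := mul_sub_le_pow_sub_pow hq 2 d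
  rw [show 2 + 1 = 3 from rfl, add_comm 2 d] at key
  have e1 := mul_le_mul_of_nonneg_left h3 (Nat.cast_nonneg d)
  push_cast
  nlinarith [key, e1]

/-- every cost is `≥ −ρ log ρ` (`u − ρ log u` is minimal at `u = ρ`), for `ρ ≥ 1`. [folklore] -/
private theorem neg_mul_log_le_cost {ρ : ℝ} (hρ : 1 ≤ ρ) {p : ℕ} (hp : 2 ≤ p) (a : ℕ) :
    -(ρ * Real.log ρ) ≤ cost ρ p a := by
  have hρ0 : 0 < ρ := by linarith
  rcases eq_or_ne a 0 with rfl | ha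
  · rw [cost_zero]; have := Real.log_nonneg hρ; nlinarith
  rw [cost_of_ne_zero _ _ ha]
  have hp0 : (0:ℝ) < p := by exact_mod_cast (by omega : 0 < p)
  set u : ℝ := (p:ℝ) ^ a with hu
  have hu0 : 0 < u := pow_pos hp0 a
  have hlog : ρ * (a * Real.log p) = ρ * Real.log u := by rw [hu, Real.log_pow]
  have h1 : Real.log (u / ρ) ≤ u / ρ - 1 := Real.log_le_sub_one_of_pos (div_pos hu0 hρ0)
  rw [Real.log_div hu0.ne' hρ0.ne'] at h1
  have h2 : ρ * (Real.log u - Real.log ρ) ≤ ρ * (u / ρ - 1) := mul_le_mul_of_nonneg_left h1 hρ0.le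
  have h3 : ρ * (u / ρ - 1) = u - ρ := by field_simp
  have h4 : ρ * (Real.log u - Real.log ρ) = ρ * Real.log u - ρ * Real.log ρ := by ring
  have h5 : ρ * ↑a * Real.log ↑p = ρ * Real.log u := by rw [← hlog]; ring
  rw [h5]; linarith [h2, h3, h4]

/-- the costs of the exponents `0, 1, 2` are `≤ p²`. [folklore] -/
private theorem cost_le_sq {ρ : ℝ} (hρ : 0 ≤ ρ) {p : ℕ} (hp : 2 ≤ p) {e : ℕ} (he : e ≤ 2) :
    cost ρ p e ≤ (p:ℝ) ^ 2 := by
  have hp2 : (2:ℝ) ≤ p := by exact_mod_cast hp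
  have hl : 0 ≤ ρ * Real.log p := mul_nonneg hρ (Real.log_nonneg (by linarith))
  interval_cases e
  · rw [cost_zero]; positivity
  · rw [cost_of_ne_zero _ _ one_ne_zero]; push_cast; nlinarith
  · rw [cost_of_ne_zero _ _ two_ne_zero]; push_cast; nlinarith

/-! ## C. The two-layer exponent pattern at `ρ = x / log x` -/

/-- `ρ(x) = x / log x`. [cite: MassiasNicolasRobin1988, §4 (6) (ρ = x₁/log x₁)] -/
noncomputable def rho (x : ℝ) : ℝ := x / Real.log x

/-- the two-layer exponent: `2` on `A₂(x) = {p ≤ x : p² − p ≤ ρ(x) log p}`, `1` on the other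
`p ≤ x`, `0` beyond `x`. [cite: MassiasNicolasRobin1988, §4 (6)–(7) (N_ρ, two layers)] -/
noncomputable def expo (x : ℝ) (p : ℕ) : ℕ :=
  if (p : ℝ) ≤ x then (if (p : ℝ) ^ 2 - p ≤ rho x * Real.log p then 2 else 1) else 0

/-- the slack carried by the primes `p` with `p³ − p² < ρ(x) log p` (all `≤ (2x)^{1/3}`).
[folklore] -/
noncomputable def slack (x : ℝ) (p : ℕ) : ℝ :=
  if (p : ℝ) ^ 3 - (p : ℝ) ^ 2 < rho x * Real.log p then (p : ℝ) ^ 2 + rho x * Real.log (rho x)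
  else 0

/-- `T(x) = Σ_{p ≤ x} e_x(p) log p = θ(x) + Σ_{p ∈ A₂(x)} log p`.
[cite: MassiasNicolasRobin1988, §4 (6) (log N_ρ)] -/
noncomputable def bigT (x : ℝ) : ℝ := ∑ p ∈ Nat.primesLE ⌊x⌋₊, (expo x p : ℝ) * Real.log p

/-- `L₂(x) = Σ_{p ≤ x} p^{e_x(p)} = Σ_{p ≤ x} p + Σ_{p ∈ A₂(x)} (p² − p)`.
[cite: MassiasNicolasRobin1988, §4 (6) (ℓ(N_ρ))] -/
noncomputable def lTwo (x : ℝ) : ℝ := ∑ p ∈ Nat.primesLE ⌊x⌋₊, powOr0 p (expo x p)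

/-- the exponents are `≤ 2`. [cite: MassiasNicolasRobin1988, §4 (6)–(7)] -/
theorem expo_le_two (x : ℝ) (p : ℕ) : expo x p ≤ 2 := by
  unfold expo; split_ifs <;> omega

/-- exponent `0` beyond `x`. [cite: MassiasNicolasRobin1988, §4 (6)–(7)] -/
theorem expo_of_lt {x : ℝ} {p : ℕ} (h : x < p) : expo x p = 0 := by
  unfold expo; rw [if_neg (not_le.2 h)]

/-- exponent `≥ 1` up to `x`. [cite: MassiasNicolasRobin1988, §4 (6)–(7)] -/
theorem one_le_expo {x : ℝ} {p : ℕ} (h : (p:ℝ) ≤ x) : 1 ≤ expo x p := by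
  unfold expo; rw [if_pos h]; split_ifs <;> omega

/-- `x/log x ≤ c/log c` for `e ≤ x ≤ c`. [folklore] -/
private theorem div_log_mono {x c : ℝ} (hx : Real.exp 1 ≤ x) (hxc : x ≤ c) :
    x / Real.log x ≤ c / Real.log c := by
  have hx0 : 0 < x := (Real.exp_pos 1).trans_le hx
  have hc0 : 0 < c := hx0.trans_le hxc
  have hlx : 0 < Real.log x :=
    Real.log_pos (lt_of_lt_of_le (by have := Real.exp_one_gt_d9; linarith) hx)
  have hlc : 0 < Real.log c :=
    Real.log_pos (lt_of_lt_of_le (by have := Real.exp_one_gt_d9; linarith) (hx.trans hxc))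
  have h := Real.log_div_self_antitoneOn hx (hx.trans hxc) hxc
  rw [div_le_div_iff₀ hlx hlc]
  rw [div_le_div_iff₀ hc0 hx0] at h
  linarith

/-- `e < 3`. [folklore] -/
private theorem exp_one_lt_three : Real.exp 1 < 3 := by
  have := Real.exp_one_lt_d9; linarith

/-- `ρ(x) ≥ 1` for `x ≥ 4`. [cite: MassiasNicolasRobin1988, §4 (6)] -/
theorem one_le_rho {x : ℝ} (hx : 4 ≤ x) : 1 ≤ rho x := by
  have hx0 : 0 < x := by linarith
  have hl : 0 < Real.log x := Real.log_pos (by linarith)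
  rw [rho, le_div_iff₀ hl]
  have := Real.log_le_sub_one_of_pos hx0; linarith

/-- `ρ log ρ ≤ x` for `x ≥ 4`. [cite: MassiasNicolasRobin1988, §4 (6)] -/
theorem rho_mul_log_rho_le {x : ℝ} (hx : 4 ≤ x) : rho x * Real.log (rho x) ≤ x := by
  have hx0 : 0 < x := by linarith
  have hl4 : 1 < Real.log 4 := by
    rw [← Real.exp_lt_exp, Real.exp_log (by norm_num)]; exact exp_one_lt_three.trans (by norm_num)
  have hl : 1 ≤ Real.log x := hl4.le.trans (Real.log_le_log (by norm_num) hx)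
  have hρ := one_le_rho hx
  have hρx : rho x ≤ x := by
    rw [rho, div_le_iff₀ (by linarith)]; nlinarith
  calc rho x * Real.log (rho x) ≤ rho x * Real.log x :=
        mul_le_mul_of_nonneg_left (Real.log_le_log (by linarith) hρx) (by linarith)
    _ = x := by rw [rho, div_mul_cancel₀ _ (by linarith)]

/-- the slack is nonnegative. [folklore] -/
private theorem slack_nonneg {x : ℝ} (hx : 4 ≤ x) (p : ℕ) : 0 ≤ slack x p := by
  unfold slack; split_ifs
  · have h1 := one_le_rho hx
    have : 0 ≤ Real.log (rho x) := Real.log_nonneg h1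
    positivity
  · exact le_rfl

/-- **Termwise weak duality**: for `x ≥ 4`, a prime `p` and any exponent `a`,
`cost (e_x p) ≤ cost a + slack`. [cite: MassiasNicolasRobin1988, §4 (4)–(7)] -/
theorem cost_expo_le {x : ℝ} (hx : 4 ≤ x) {p : ℕ} (hp : p.Prime) (a : ℕ) :
    cost (rho x) p (expo x p) ≤ cost (rho x) p a + slack x p := by
  have hp2 := hp.two_le
  have hp2r : (2:ℝ) ≤ p := by exact_mod_cast hp2
  have he4 : Real.exp 1 ≤ 4 := (exp_one_lt_three.trans (by norm_num)).le
  have hρ1 := one_le_rho hx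
  have hρ0 : 0 ≤ rho x := by linarith
  have hlp : 0 < Real.log p := Real.log_pos (by linarith)
  by_cases hpx : (p:ℝ) ≤ x
  · by_cases hsl : (p : ℝ) ^ 3 - (p : ℝ) ^ 2 < rho x * Real.log p
    · -- slack prime
      rw [slack, if_pos hsl]
      have h1 := cost_le_sq hρ0 hp2 (expo_le_two x p)
      have h2 := neg_mul_log_le_cost hρ1 hp2 a
      linarith
    rw [slack, if_neg hsl, add_zero]
    push Not at hsl
    by_cases hA : (p : ℝ) ^ 2 - p ≤ rho x * Real.log p
    · have : expo x p = 2 := by unfold expo; rw [if_pos hpx, if_pos hA]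
      rw [this]; exact cost_two_le hp2 hA hsl a
    · have : expo x p = 1 := by unfold expo; rw [if_pos hpx, if_neg hA]
      rw [this]
      push Not at hA
      refine cost_one_le hp2 ?_ hA.le a
      -- p ≤ ρ log p ⟸ p/log p ≤ x/log x
      have key : (p:ℝ) / Real.log p ≤ rho x := by
        rcases Nat.lt_or_ge p 3 with h3 | h3
        · have : p = 2 := by omega
          subst this
          have h4 : ((2:ℕ):ℝ) / Real.log (2:ℕ) = 4 / Real.log 4 := by
            have : Real.log 4 = 2 * Real.log 2 := by
              rw [show (4:ℝ) = 2 ^ 2 by norm_num, Real.log_pow]; norm_num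
            rw [this]; push_cast; field_simp; ring
          rw [h4]; exact div_log_mono he4 hx
        · exact div_log_mono (exp_one_lt_three.le.trans (by exact_mod_cast h3)) hpx
      rwa [div_le_iff₀ hlp] at key
  · -- p > x: exponent 0
    push Not at hpx
    rw [expo_of_lt hpx]
    have key : rho x ≤ (p:ℝ) / Real.log p := div_log_mono (he4.trans hx) hpx.le
    have h1 : rho x * Real.log p ≤ p := by rwa [le_div_iff₀ hlp] at key
    have := cost_zero_le hp2 h1 a
    linarith [slack_nonneg hx p]


/-! ## D. Summation: weak duality, the slack bound, and the reduction -/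

/-- `e ≤ 4`. [folklore] -/
private theorem exp_one_le_four : Real.exp 1 ≤ 4 := (exp_one_lt_three.trans (by norm_num)).le

/-- `θ(x) ≤ T(x)`. [cite: MassiasNicolasRobin1988, §4 (6)] -/
theorem theta_le_bigT {x : ℝ} (hx : 0 ≤ x) : θ x ≤ bigT x := by
  rw [Chebyshev.theta_eq_sum_primesLE, bigT]
  refine Finset.sum_le_sum fun p hp ↦ ?_
  rw [Nat.mem_primesLE] at hp
  have hpx : (p:ℝ) ≤ x := (Nat.cast_le.2 hp.1).trans (Nat.floor_le hx)
  have hl : 0 ≤ Real.log p := Real.log_nonneg (by exact_mod_cast hp.2.one_lt.le)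
  have h1 : (1:ℝ) ≤ expo x p := by exact_mod_cast one_le_expo hpx
  nlinarith

/-- a prime carrying slack is `< 2 x^{1/3}` and its slack is `≤ 4 x^{2/3} + x`. [folklore] -/
private theorem slack_aux {x : ℝ} (hx : 4 ≤ x) {p : ℕ} (hp : p.Prime) (hs : slack x p ≠ 0) :
    (p:ℝ) < 2 * x ^ ((1:ℝ)/3) ∧ slack x p ≤ 4 * (x ^ ((1:ℝ)/3)) ^ 2 + x := by
  have hx0 : 0 < x := by linarith
  set y := x ^ ((1:ℝ)/3) with hy
  have hy0 : 0 < y := Real.rpow_pos_of_pos hx0 _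
  have hy3 : y ^ 3 = x := by
    rw [hy, ← Real.rpow_natCast, ← Real.rpow_mul hx0.le]; norm_num
  have hp2 := hp.two_le
  have hp2r : (2:ℝ) ≤ p := by exact_mod_cast hp2
  have hlp : 0 < Real.log p := Real.log_pos (by linarith)
  have hcond : (p : ℝ) ^ 3 - (p : ℝ) ^ 2 < rho x * Real.log p := by
    by_contra h; exact hs (by rw [slack, if_neg h])
  have hρ1 := one_le_rho hx
  -- p ≤ x
  have hpx : (p:ℝ) ≤ x := by
    by_contra h
    push Not at h
    have key : rho x ≤ (p:ℝ) / Real.log p := div_log_mono (exp_one_le_four.trans hx) h.le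
    rw [le_div_iff₀ hlp] at key
    nlinarith
  have hl : Real.log p ≤ Real.log x := Real.log_le_log (by linarith) hpx
  have h1 : rho x * Real.log p ≤ x := by
    calc rho x * Real.log p ≤ rho x * Real.log x := mul_le_mul_of_nonneg_left hl (by linarith)
      _ = x := by rw [rho, div_mul_cancel₀ _ (Real.log_pos (by linarith)).ne']
  have h2 : (p:ℝ) ^ 3 < (2 * y) ^ 3 := by nlinarith
  have h3 : (p:ℝ) < 2 * y := lt_of_pow_lt_pow_left₀ 3 (by positivity) h2
  refine ⟨h3, ?_⟩
  rw [slack, if_pos hcond]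
  have h4 : (p:ℝ) ^ 2 < (2 * y) ^ 2 := by nlinarith
  have h5 := rho_mul_log_rho_le hx
  nlinarith

/-- **the slack bound** `Σ_p slack ≤ 10 x^{4/3}` (only primes `< 2x^{1/3}` carry slack, each
`≤ 4x^{2/3} + x`). [folklore] -/
private theorem sum_slack_le {x : ℝ} (hx : 4 ≤ x) {S : Finset ℕ} (hS : ∀ p ∈ S, p.Prime) :
    ∑ p ∈ S, slack x p ≤ 10 * (x * x ^ ((1:ℝ)/3)) := by
  classical
  have hx0 : 0 < x := by linarith
  set y := x ^ ((1:ℝ)/3) with hy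
  have hy1 : 1 ≤ y := Real.one_le_rpow (by linarith) (by norm_num)
  have hy3 : y ^ 3 = x := by
    rw [hy, ← Real.rpow_natCast, ← Real.rpow_mul hx0.le]; norm_num
  rw [← Finset.sum_filter_ne_zero]
  set F := S.filter (fun p ↦ slack x p ≠ 0) with hF
  have hcard : (F.card : ℝ) ≤ 2 * y := by
    have hsub : F ⊆ Finset.Icc 2 ⌊2 * y⌋₊ := by
      intro p hp
      rw [hF, Finset.mem_filter] at hp
      have h := slack_aux hx (hS p hp.1) hp.2
      rw [Finset.mem_Icc]
      exact ⟨(hS p hp.1).two_le, Nat.le_floor h.1.le⟩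
    have h1 := Finset.card_le_card hsub
    rw [Nat.card_Icc] at h1
    have h2 : (F.card : ℝ) ≤ ((⌊2 * y⌋₊ + 1 - 2 : ℕ) : ℝ) := by exact_mod_cast h1
    have h3 : ((⌊2 * y⌋₊ + 1 - 2 : ℕ) : ℝ) ≤ (⌊2 * y⌋₊ : ℝ) := by
      exact_mod_cast (by omega : ⌊2 * y⌋₊ + 1 - 2 ≤ ⌊2 * y⌋₊)
    exact h2.trans (h3.trans (Nat.floor_le (by linarith)))
  have hle : ∀ p ∈ F, slack x p ≤ 4 * y ^ 2 + x := by
    intro p hp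
    rw [hF, Finset.mem_filter] at hp
    exact (slack_aux hx (hS p hp.1) hp.2).2
  calc ∑ p ∈ F, slack x p ≤ ∑ p ∈ F, (4 * y ^ 2 + x) := Finset.sum_le_sum hle
    _ = F.card * (4 * y ^ 2 + x) := by rw [Finset.sum_const, nsmul_eq_mul]
    _ ≤ 2 * y * (4 * y ^ 2 + x) := mul_le_mul_of_nonneg_right hcard (by positivity)
    _ = 8 * x + 2 * (x * y) := by rw [← hy3]; ring
    _ ≤ 10 * (x * y) := by nlinarith

/-- **Weak duality** for `ℓ`: with `x = log k ≥ 4` and `ρ = x/log x`,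
`ℓ(k) − ρ x ≥ L₂(x) − ρ T(x) − 10 x^{4/3}`. [cite: MassiasNicolasRobin1988, §4 (4)–(7)] -/
theorem lTwo_sub_le_ell_sub {k : ℕ} (hk : 4 ≤ Real.log k) :
    lTwo (Real.log k) - rho (Real.log k) * bigT (Real.log k)
        - 10 * (Real.log k * Real.log k ^ ((1:ℝ)/3))
      ≤ (ell k : ℝ) - rho (Real.log k) * Real.log k := by
  set x := Real.log k with hxdef
  have hx0 : 0 < x := by linarith
  have hk1 : 1 < (k:ℝ) := by
    by_contra h
    push Not at h
    have : Real.log k ≤ 0 := Real.log_nonpos (by positivity) h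
    linarith
  have hk0 : k ≠ 0 := by rintro rfl; norm_num at hk1
  have hxk : ⌊x⌋₊ ≤ k := by
    have h1 : x ≤ k := by
      have := Real.log_le_sub_one_of_pos (by linarith : (0:ℝ) < k); rw [hxdef]; linarith
    have := Nat.floor_le_floor h1
    rwa [Nat.floor_natCast] at this
  set S := Nat.primesLE k with hSdef
  have hSp : ∀ p ∈ S, p.Prime := fun p hp ↦ (Nat.mem_primesLE.1 hp).2
  have hS : k.primeFactors ⊆ S := by
    intro p hp
    rw [hSdef, Nat.mem_primesLE]
    exact ⟨Nat.le_of_mem_primeFactors hp, Nat.prime_of_mem_primeFactors hp⟩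
  rw [ell_sub_mul_log_eq k (rho x) hS]
  have h1 : ∑ p ∈ S, (cost (rho x) p (expo x p) - slack x p)
      ≤ ∑ p ∈ S, cost (rho x) p (k.factorization p) :=
    Finset.sum_le_sum fun p hp ↦ by linarith [cost_expo_le hk (hSp p hp) (k.factorization p)]
  rw [Finset.sum_sub_distrib] at h1
  have hsub : Nat.primesLE ⌊x⌋₊ ⊆ S := by
    intro p hp
    rw [Nat.mem_primesLE] at hp ⊢
    exact ⟨hp.1.trans hxk, hp.2⟩
  have h2 : ∑ p ∈ S, cost (rho x) p (expo x p) = lTwo x - rho x * bigT x := by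
    rw [← Finset.sum_subset hsub]
    · rw [lTwo, bigT, Finset.mul_sum, ← Finset.sum_sub_distrib]
      refine Finset.sum_congr rfl fun p _ ↦ ?_
      rw [cost]; ring
    · intro p hpS hpn
      have hp := hSp p hpS
      have : ¬ (p ≤ ⌊x⌋₊) := fun h ↦ hpn (Nat.mem_primesLE.2 ⟨h, hp⟩)
      have hxp : x < p := Nat.lt_of_floor_lt (by omega)
      rw [expo_of_lt hxp, cost_zero]
  have h3 := sum_slack_le hk hSp
  linarith

/-- **The RH-free reduction** (in terms of `J(t) = li(t²) − li(4)`): for `x = log k ≥ 4` with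
`θ(x) ≥ e`, `J(log k) − ℓ(k) ≤ J(T(x)) − L₂(x) + 10 x^{4/3}`.
[cite: MassiasNicolasRobin1988, §4 (4)–(7) and §6 (convexity of t ↦ Li(t²))] -/
theorem liSq_log_sub_ell_le {k : ℕ} (hk : 4 ≤ Real.log k) (hθ : Real.exp 1 ≤ θ (Real.log k)) :
    LandauFnOmega.liSq (Real.log k) - ell k ≤
      LandauFnOmega.liSq (bigT (Real.log k)) - lTwo (Real.log k)
        + 10 * (Real.log k * Real.log k ^ ((1:ℝ)/3)) := by
  set x := Real.log k with hxdef
  have hT : Real.exp 1 ≤ bigT x := hθ.trans (theta_le_bigT (by linarith))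
  have hconv := LandauFnOmega.mul_div_log_le_liSq_sub (exp_one_le_four.trans hk) hT
  have hdual := lTwo_sub_le_ell_sub hk
  rw [← hxdef] at hdual
  simp only [rho] at hdual
  have : bigT x * (x / Real.log x) = x / Real.log x * bigT x := mul_comm _ _
  nlinarith [hconv, hdual, this]

/-- **The RH-free reduction**: for `x = log k ≥ 4` with `θ(x) ≥ e`,
`li((log k)²) − ℓ(k) ≤ li(T(x)²) − L₂(x) + 10 x^{4/3}`.
[cite: MassiasNicolasRobin1988, §4 (4)–(7) and §6 (convexity of t ↦ Li(t²))] -/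
theorem logIntegral_sq_log_sub_ell_le {k : ℕ} (hk : 4 ≤ Real.log k)
    (hθ : Real.exp 1 ≤ θ (Real.log k)) :
    logIntegral (Real.log k ^ 2) - ell k ≤
      logIntegral (bigT (Real.log k) ^ 2) - lTwo (Real.log k)
        + 10 * (Real.log k * Real.log k ^ ((1:ℝ)/3)) := by
  have hT : Real.exp 1 ≤ bigT (Real.log k) := hθ.trans (theta_le_bigT (by linarith))
  have he2 : (2:ℝ) < Real.exp 1 := by have := Real.exp_one_gt_d9; linarith
  rw [LandauFnOmega.logIntegral_sq_eq (by linarith), LandauFnOmega.logIntegral_sq_eq (by linarith)]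
  linarith [liSq_log_sub_ell_le hk hθ]

/-- **Consequence for `g(n)`**: if `li(T(x)²) − L₂(x) + 10x^{4/3} < 0` at `x = log g(n) ≥ 4` (and
`θ(x) ≥ e`), then `log g(n) < √(li⁻¹(n))`. [cite: MassiasNicolasRobin1988, Thm. 1 (iv)] -/
theorem log_landauFn_lt_sqrt {n : ℕ} {y : ℝ} (hy : 1 < y) (hn : logIntegral y = n)
    (hk : 4 ≤ Real.log (landauFn n)) (hθ : Real.exp 1 ≤ θ (Real.log (landauFn n)))
    (hneg : logIntegral (bigT (Real.log (landauFn n)) ^ 2) - lTwo (Real.log (landauFn n))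
        + 10 * (Real.log (landauFn n) * Real.log (landauFn n) ^ ((1:ℝ)/3)) < 0) :
    Real.log (landauFn n) < Real.sqrt y := by
  have h1 := logIntegral_sq_log_sub_ell_le hk hθ
  have h2 : (ell (landauFn n) : ℝ) ≤ n := by exact_mod_cast ell_landauFn_le n
  have h3 : logIntegral (Real.log (landauFn n) ^ 2) < logIntegral y := by rw [hn]; linarith
  have hx0 : 0 < Real.log (landauFn n) := by linarith
  have h4 : Real.log (landauFn n) ^ 2 < y := by
    by_contra h
    push Not at h
    have hmono : StrictMonoOn logIntegral (Set.Ioi 1) := strictMonoOn_logIntegral_holds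
    have := hmono.le_iff_le (show y ∈ Set.Ioi (1:ℝ) from hy)
      (show Real.log (landauFn n) ^ 2 ∈ Set.Ioi (1:ℝ) by
        show (1:ℝ) < Real.log (landauFn n) ^ 2; nlinarith)
    exact absurd (this.2 h) (not_le.2 h3)
  rw [← Real.sqrt_sq hx0.le]
  exact Real.sqrt_lt_sqrt (by positivity) h4


/-! ## E. `g(n) = max {k : ℓ(k) ≤ n}` (MNR §4 (3)) and monotonicity of `g` -/

/-- **`ℓ(k) ≤ n ⟹ k ≤ g(n)`** for `k ≥ 1`: the permutation of `n` letters with one `p^a`-cycle for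
each `p^a ∥ k` (and fixed points) has order `k`. With `ell_landauFn_le` this is MNR's
`g(n) = max_{ℓ(k) ≤ n} k`. [cite: MassiasNicolasRobin1988, §4 (3)] -/
theorem le_landauFn_of_ell_le {k n : ℕ} (hk : k ≠ 0) (h : ell k ≤ n) : k ≤ landauFn n := by
  classical
  -- the cycle type: the prime-power parts of `k`
  set m : Multiset ℕ := k.primeFactors.val.map (fun p ↦ p ^ k.factorization p) with hm
  have hsum : m.sum = ell k := by
    rw [hm, ell, Finset.sum_eq_multiset_sum]
  have htwo : ∀ a ∈ m, 2 ≤ a := by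
    intro a ha
    rw [hm, Multiset.mem_map] at ha
    obtain ⟨p, hp, rfl⟩ := ha
    have hp' := Nat.prime_of_mem_primeFactors (Finset.mem_def.2 hp)
    have hv : k.factorization p ≠ 0 := fun h0 ↦
      (factorization_eq_zero_iff_notMem.1 h0) (Finset.mem_def.2 hp)
    calc 2 ≤ p := hp'.two_le
      _ = p ^ 1 := (pow_one p).symm
      _ ≤ p ^ k.factorization p := Nat.pow_le_pow_right hp'.pos (Nat.one_le_iff_ne_zero.mpr hv)
  have hex : ∃ g : Equiv.Perm (Fin n), g.cycleType = m := by
    rw [Equiv.Perm.exists_with_cycleType_iff]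
    exact ⟨by rw [Fintype.card_fin, hsum]; exact h, htwo⟩
  obtain ⟨g, hg⟩ := hex
  have hord : orderOf g = m.lcm := by rw [← Equiv.Perm.lcm_cycleType, hg]
  have hl0 : m.lcm ≠ 0 := by
    rw [Ne, Multiset.lcm_eq_zero_iff]
    intro h0; have := htwo 0 h0; omega
  -- `k ∣ lcm m`, prime power by prime power
  have hdvd : k ∣ m.lcm := by
    rw [← Nat.factorization_prime_le_iff_dvd hk hl0]
    intro p hp
    by_cases hpk : p ∈ k.primeFactors
    · have hmem : p ^ k.factorization p ∈ m := by
        rw [hm, Multiset.mem_map]; exact ⟨p, Finset.mem_def.1 hpk, rfl⟩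
      have h1 : p ^ k.factorization p ∣ m.lcm := Multiset.dvd_lcm hmem
      exact (hp.pow_dvd_iff_le_factorization hl0).1 h1
    · rw [factorization_eq_zero_iff_notMem.2 hpk]; exact Nat.zero_le _
  calc k ≤ m.lcm := Nat.le_of_dvd (Nat.pos_of_ne_zero hl0) hdvd
    _ = orderOf g := hord.symm
    _ ≤ landauFn n := orderOf_le_landauFn g

/-- `g(n) ≥ 1`. [cite: DelegliseNicolas2019, §1.1] -/
theorem one_le_landauFn (n : ℕ) : 1 ≤ landauFn n := by
  simpa using orderOf_le_landauFn (1 : Equiv.Perm (Fin n))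

/-- **MNR §4 (3): `g(n) = max {k ≥ 1 : ℓ(k) ≤ n}`.** [cite: MassiasNicolasRobin1988, §4 (3)] -/
theorem isGreatest_landauFn (n : ℕ) :
    IsGreatest {k : ℕ | k ≠ 0 ∧ ell k ≤ n} (landauFn n) :=
  ⟨⟨Nat.one_le_iff_ne_zero.1 (one_le_landauFn n), ell_landauFn_le n⟩,
    fun _ hk ↦ le_landauFn_of_ell_le hk.1 hk.2⟩

/-- **`g` is nondecreasing** (`𝔖ₙ ↪ 𝔖ₘ` for `n ≤ m`; here via `ℓ(g(n)) ≤ n ≤ m`).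
[cite: DelegliseNicolas2019, §1.1] -/
theorem landauFn_mono : Monotone landauFn := fun n _ hnm ↦
  le_landauFn_of_ell_le (Nat.one_le_iff_ne_zero.1 (one_le_landauFn n))
    ((ell_landauFn_le n).trans hnm)

end LandauFnUpper

end Literature.NumberTheory.LFunctions
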